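import Literature.Probability.RandomPlanarGeometry.SpinObservableShortTime
import Literature.Probability.RandomPlanarGeometry.ObservableDiscretePassage
import HarnessLib

/-!
# The spin observable martingale property passes to the scaling limit of the driving processes

Topic `Literature/Probability/RandomPlanarGeometry` (deterministic Loewner theory + abstract
probability; no lattice model); theorems only. Spin-Ising companion of
`ObservableLimitPassage.lean` / `ObservableDiscretePassage.lean` (FK observable), serving the
spin half of **crit-ising.S17** (Chelkak–Duminil-Copin–Hongler–Kemppainen–Smirnov, C. R. Math.
352 (2014), Thm. 1; tree: the named fact (M)
`Literature.Probability.LatticeModels.exists_drivingMartingales_of_subseqLimit_spinInterface`,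
reduced in `LatticeModels/InterfaceSLECylinder.lean` to the cylinder identity of the
time-limited spin observable `N^y = Loewner.spinObservableProcess W y` of
`SpinObservableShortTime.lean`). The printed proof of that identity (CDHKS §3, p. 7 of
arXiv:1312.0533) has two lattice inputs — the convergence of the driving processes `W^δ → W`
(Kemppainen–Smirnov 2017 = CDHKS Thm. 3) and the discrete fermionic observable martingale
`F^δ_n(z)` with `|F^δ_n(z) - M^δ_t(z)| → 0` "uniformly over all possible domains" (Chelkak–Smirnov
2012, Thms 1.2, 5.6) — and one analytic step:

> "Using the convergence `w^δ → w`, the equicontinuity (in `t`) of `g_t^δ` and the convergence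
> of `G_t^δ` to `G_t` in the bulk of `ℍ_t` (which follows from the convergences of `W^δ_t` to
> `W_t`), we conclude that for any `z ∈ Ω`, the process `M_t(z)` …, `t ≤ T(z)`, … is a
> martingale with respect to the filtration `(ℱ_t)_{t≥0}` generated by `W_t`."

The tree proves this step abstractly for any bounded family of path functionals `N_u(w)`
jointly continuous in `(u, w)` (`Loewner.integral_cylinder_eq_zero_of_discreteMartingales`,
`ObservableDiscretePassage.lean`). This file verifies the hypothesis for the spin observable and
specialises:

* `Loewner.exists_norm_mapSub_sub_mapSub_le_of_le_cdhksTime`,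
  `Loewner.continuous_mapSub_min_cdhksTime` — `G_{u ∧ T(iy)}(w) = g_{u∧T}(iy) - w_{u∧T}` is
  jointly continuous in `(u, w) ∈ [0, ∞) × C([0, ∞), ℝ)` (driver stability of the Loewner map,
  `ShortTime.dist_map_le`, uniformly in `u ≤ T(iy) = y²/9`; time continuity for a fixed driver);
* **`Loewner.continuous_contSpinObservable_min_cdhksTime`** — the time-limited spin observable
  `(u, w) ↦ contSpinObservable w (u ∧ T(iy)) (iy) = O^{FK} · (iy/G)^{1/2}` is jointly continuous
  (the FK factor by `continuous_fkObservable_min_cdhksTime`; `Re (iy/G) > 0`, where the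
  principal square root is continuous) — "the equicontinuity (in `t`) … and the convergence of
  `G_t^δ` to `G_t`";
* `Loewner.integral_spinObservableProcess_cylinder_eq_zero_of_forall_lt` — the cylinder identity
  for all `s ≤ t` from the cases `s < t < T(iy)` (the observable is frozen after `T(iy)` and
  continuous in time; dominated convergence);
* **`Loewner.integral_spinObservableProcess_cylinder_eq_zero_of_discreteMartingales`** — the
  cylinder identity for a limit `(W, μ)` of driving processes from discrete observable
  martingales at every scale: what then remains of (M) is (J) the convergence in distribution
  of the capacity driving processes of the spin interfaces along the subsequence with the
  regularity of the limit (Kemppainen–Smirnov 2017) and (D) the discrete spin observable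
  martingale with Chelkak–Smirnov's convergence theorem in the slit domains, in the shape of the
  hypothesis `hD` below.

No definition and no named fact is introduced.

## References

* D. Chelkak, H. Duminil-Copin, C. Hongler, A. Kemppainen, S. Smirnov, *Convergence of Ising
  interfaces to Schramm's SLE curves*, C. R. Math. Acad. Sci. Paris 352 (2014) 157–161
  (arXiv:1312.0533), Thm. 3 and §3 (p. 7).
* D. Chelkak, S. Smirnov, *Universality in the 2D Ising model and conformal invariance of
  fermionic observables*, Invent. Math. 189 (2012) 515–580, Thms 1.2, 5.6.
* A. Kemppainen, S. Smirnov, *Random curves, scaling limits and Loewner evolutions*, Ann.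
  Probab. 45 (2017) 698–779, Thm. 1.5, Cor. 1.7.
* G. F. Lawler, *Conformally Invariant Processes in the Plane*, AMS (2005), §4.7 (driver
  stability).
-/

noncomputable section

open MeasureTheory Filter Topology Complex Set Metric
open scoped NNReal ENNReal

namespace Literature.Probability.RandomPlanarGeometry

namespace Loewner

/-! ### Joint continuity of `G_t = g_t(iy) - W_t` and of the spin observable in (time, driver) -/

/-- **Uniform-in-time driver stability of `G_t = g_t(iy) - W_t`.** For `y > 0` there are
`ω₀ > 0` and `M ≥ 0` (depending only on `y`) such that for all continuous drivers `W₀, W`, all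
`t ≤ T(iy) = y²/9` and all `ω ∈ [0, ω₀]`, `|W₀ - W| ≤ ω` on `[0, t]` implies
`‖(g^W_t(iy) - W_t) - (g^{W₀}_t(iy) - W₀_t)‖ ≤ M ω` (`ShortTime.dist_map_le`:
`‖g^W_t - g^{W₀}_t‖ ≤ ω (e^{18t/y²} - 1) ≤ ω (e² - 1)`; `M = e²`). [folklore] -/
theorem exists_norm_mapSub_sub_mapSub_le_of_le_cdhksTime {y : ℝ} (hy : 0 < y) :
    ∃ ω₀ > 0, ∃ M ≥ 0, ∀ (W₀ W : ℝ≥0 → ℝ), Continuous W₀ → Continuous W →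
      ∀ t ≤ cdhksTime y, ∀ ω, 0 ≤ ω → ω ≤ ω₀ → (∀ s : ℝ≥0, s ≤ t → |W₀ s - W s| ≤ ω) →
        ‖(map W t (I * y) - W t) - (map W₀ t (I * y) - W₀ t)‖ ≤ M * ω := by
  set Es : ℝ := Real.exp 2 with hEs
  have hEs0 : 0 < Es := Real.exp_pos _
  set ω₀ : ℝ := y / 6 / (Es + 1) with hω₀
  have hω₀pos : 0 < ω₀ := by positivity
  refine ⟨ω₀, hω₀pos, Es, hEs0.le, fun W₀ W hW₀ hW t ht ω hω0 hωle hWW ↦ ?_⟩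
  have hyim : (I * (y : ℂ)).im = y := by simp
  have hST : ShortTime W₀ (I * y) t := (shortTime_cdhksTime hW₀ hy).mono ht
  have htreal : (t : ℝ) ≤ y ^ 2 / 9 := by
    have := NNReal.coe_le_coe.2 ht
    rwa [coe_cdhksTime] at this
  set E : ℝ := Real.exp (18 / y ^ 2 * t) with hE
  have hE0 : 0 < E := Real.exp_pos _
  have hEle : E ≤ Es := by
    refine Real.exp_le_exp.2 ?_
    have h1 : 18 / y ^ 2 * (t : ℝ) ≤ 18 / y ^ 2 * (y ^ 2 / 9) := by gcongr
    have h2 : 18 / y ^ 2 * (y ^ 2 / 9) = 2 := by field_simp; ring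
    linarith
  have hω1 : ω ≤ (I * (y : ℂ)).im / 6 := by
    rw [hyim]
    calc ω ≤ y / 6 / (Es + 1) := hωle
      _ ≤ y / 6 := div_le_self (by positivity) (by linarith)
  have hω2 : ω * (Real.exp (18 / (I * (y : ℂ)).im ^ 2 * t) - 1) < (I * (y : ℂ)).im / 6 := by
    rw [hyim, ← hE]
    have h1 : ω * (E - 1) ≤ ω₀ * Es := by nlinarith
    have h2 : ω₀ * Es < y / 6 := by
      rw [hω₀, div_mul_eq_mul_div, div_lt_iff₀ (by positivity)]
      nlinarith
    linarith
  have hmap := hST.dist_map_le hW hω0 hω1 hω2 hWW le_rfl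
  rw [hyim, ← hE, dist_eq_norm] at hmap
  have hWt : |W₀ t - W t| ≤ ω := hWW t le_rfl
  have hWt' : ‖((W t : ℝ) : ℂ) - ((W₀ t : ℝ) : ℂ)‖ ≤ ω := by
    rw [← ofReal_sub, norm_real, Real.norm_eq_abs, abs_sub_comm]; exact hWt
  calc ‖(map W t (I * y) - W t) - (map W₀ t (I * y) - W₀ t)‖
      = ‖(map W t (I * y) - map W₀ t (I * y)) - ((W t : ℂ) - (W₀ t : ℂ))‖ := by ring_nf
    _ ≤ ‖map W t (I * y) - map W₀ t (I * y)‖ + ‖(W t : ℂ) - (W₀ t : ℂ)‖ := norm_sub_le _ _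
    _ ≤ ω * (E - 1) + ω := add_le_add hmap hWt'
    _ = E * ω := by ring
    _ ≤ Es * ω := by gcongr

/-- **`G_{u ∧ T(iy)}(w) = g_{u∧T}(iy) - w_{u∧T}` is jointly continuous in (time, driving path)** on
`[0, ∞) × C([0, ∞), ℝ)` (compact-open topology): continuity in `u` for fixed `w`
(`ShortTime.continuousOn_map`), continuity in `w` uniformly in `u ≤ T(iy)`
(`exists_norm_mapSub_sub_mapSub_le_of_le_cdhksTime`), and the tubes
`{w | |w - w₀| < ω on [0, T(iy)]}` are neighbourhoods of `w₀`
(`ContinuousMap.tendsto_iff_forall_isCompact_tendstoUniformlyOn`). This is "the convergence of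
`G_t^δ` to `G_t` … (which follows from the convergences of `W_t^δ` to `W_t`)" of CDHKS (2014),
§3. [cite: CDHKSCRAS2014, §3] -/
theorem continuous_mapSub_min_cdhksTime {y : ℝ} (hy : 0 < y) :
    Continuous fun p : ℝ≥0 × C(ℝ≥0, ℝ) ↦
      map p.2 (min p.1 (cdhksTime y)) (I * y) - p.2 (min p.1 (cdhksTime y)) := by
  set b : (ℝ≥0 → ℝ) → ℝ≥0 → ℂ := fun W t ↦ map W t (I * y) - W t with hb
  change Continuous fun p : ℝ≥0 × C(ℝ≥0, ℝ) ↦ b p.2 (min p.1 (cdhksTime y))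
  obtain ⟨ω₀, hω₀, M, hM, hstab⟩ := exists_norm_mapSub_sub_mapSub_le_of_le_cdhksTime hy
  rw [continuous_iff_continuousAt]
  rintro ⟨u₀, w₀⟩
  rw [ContinuousAt, Metric.tendsto_nhds]
  intro ε hε
  -- continuity in time at the fixed driver `w₀`
  have htime : Continuous fun u : ℝ≥0 ↦ b w₀ (min u (cdhksTime y)) := by
    have hST := shortTime_cdhksTime w₀.continuous hy
    have hon : ContinuousOn (fun s : ℝ≥0 ↦ b w₀ s) (Icc 0 (cdhksTime y)) :=
      hST.continuousOn_map.sub (continuous_ofReal.comp w₀.continuous).continuousOn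
    exact hon.comp_continuous (continuous_id.min continuous_const)
      fun _ ↦ ⟨bot_le, min_le_right _ _⟩
  have h1 : ∀ᶠ u in 𝓝 u₀, dist (b w₀ (min u (cdhksTime y))) (b w₀ (min u₀ (cdhksTime y))) < ε / 2 :=
    Metric.tendsto_nhds.1 (htime.tendsto u₀) (ε / 2) (half_pos hε)
  -- closeness of the drivers on `[0, T(iy)]`
  set ω : ℝ := min ω₀ (ε / 2 / (M + 1)) with hω
  have hωpos : 0 < ω := by positivity
  have h2 : ∀ᶠ w in 𝓝 w₀, ∀ s ∈ Icc (0 : ℝ≥0) (cdhksTime y), dist (w₀ s) (w s) < ω := by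
    have := (ContinuousMap.tendsto_iff_forall_isCompact_tendstoUniformlyOn.1
      (tendsto_id (x := 𝓝 w₀))) (Icc 0 (cdhksTime y)) isCompact_Icc
    exact (Metric.tendstoUniformlyOn_iff.1 this) ω hωpos
  rw [nhds_prod_eq]
  refine (h1.prod_mk h2).mono ?_
  rintro ⟨u, w⟩ ⟨hu, hw⟩
  simp only at hu hw ⊢
  set t := min u (cdhksTime y) with ht
  have htT : t ≤ cdhksTime y := min_le_right _ _
  have hWW : ∀ s : ℝ≥0, s ≤ t → |w₀ s - w s| ≤ ω := fun s hs ↦ by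
    have := hw s ⟨bot_le, hs.trans htT⟩
    rw [Real.dist_eq] at this
    exact this.le
  have hstab' := hstab w₀ w w₀.continuous w.continuous t htT ω hωpos.le (min_le_left _ _) hWW
  have hMω : M * ω ≤ ε / 2 := by
    have h3 : ω ≤ ε / 2 / (M + 1) := min_le_right _ _
    have h4 : ω * (M + 1) ≤ ε / 2 := by rwa [le_div_iff₀ (by positivity)] at h3
    nlinarith
  calc dist (b w t) (b w₀ (min u₀ (cdhksTime y)))
      ≤ dist (b w t) (b w₀ t) + dist (b w₀ t) (b w₀ (min u₀ (cdhksTime y))) := dist_triangle _ _ _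
    _ < ε / 2 + ε / 2 := by
        refine add_lt_add_of_le_of_lt ?_ hu
        rw [dist_eq_norm]
        exact hstab'.trans hMω
    _ = ε := by ring

/-- **The time-limited spin observable `N^y_u(w) = contSpinObservable w (u ∧ T(iy)) (iy)` is
jointly continuous in (time, driving path)** on `[0, ∞) × C([0, ∞), ℝ)`: it is the product of
the time-limited FK observable (`continuous_fkObservable_min_cdhksTime`) and of the principal
square root of `iy/G_{u∧T}(w)`, which is jointly continuous (`continuous_mapSub_min_cdhksTime`,
`G ≠ 0`) with values of positive real part, where the principal square root is continuous.
This is "the equicontinuity (in `t`) of `g_t^δ` and the convergence of `G_t^δ` to `G_t`" of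
CDHKS (2014), §3, for the spin observable. [cite: CDHKSCRAS2014, §3] -/
theorem continuous_contSpinObservable_min_cdhksTime {y : ℝ} (hy : 0 < y) :
    Continuous fun p : ℝ≥0 × C(ℝ≥0, ℝ) ↦ contSpinObservable p.2 (min p.1 (cdhksTime y)) (I * y) := by
  have hG := continuous_mapSub_min_cdhksTime hy
  have hq : Continuous fun p : ℝ≥0 × C(ℝ≥0, ℝ) ↦
      I * y / (map p.2 (min p.1 (cdhksTime y)) (I * y) - p.2 (min p.1 (cdhksTime y))) :=
    continuous_const.div hG fun p ↦ (shortTime_min_cdhksTime p.2.continuous hy p.1).map_sub_ne_zero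
  have hroot : Continuous fun p : ℝ≥0 × C(ℝ≥0, ℝ) ↦
      (I * y / (map p.2 (min p.1 (cdhksTime y)) (I * y) - p.2 (min p.1 (cdhksTime y)))) ^ (2⁻¹ : ℂ) := by
    rw [continuous_iff_continuousAt] at hq ⊢
    intro p
    have hmem := (shortTime_min_cdhksTime p.2.continuous hy p.1).div_map_sub_mem_slitPlane
    exact ContinuousAt.comp (g := fun x : ℂ ↦ x ^ (2⁻¹ : ℂ)) (continuousAt_cpow_const hmem) (hq p)
  have hf := continuous_fkObservable_min_cdhksTime hy
  show Continuous fun p : ℝ≥0 × C(ℝ≥0, ℝ) ↦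
    fkObservable p.2 (min p.1 (cdhksTime y)) (I * y) *
      (I * y / (map p.2 (min p.1 (cdhksTime y)) (I * y) - p.2 (min p.1 (cdhksTime y)))) ^ (2⁻¹ : ℂ)
  exact hf.mul hroot

/-! ### The cylinder identity of the spin observable from discrete martingales -/

section DiscretePassage

open Literature.Probability.Process

variable {Ω : Type*} {mΩ : MeasurableSpace Ω} {μ : Measure Ω} [IsProbabilityMeasure μ]
  {Ω' : ℕ → Type*} {mΩ' : ∀ k, MeasurableSpace (Ω' k)} {P : ∀ k, Measure (Ω' k)}
  [∀ k, IsProbabilityMeasure (P k)]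
  [MeasurableSpace C(ℝ≥0, ℝ)] [OpensMeasurableSpace C(ℝ≥0, ℝ)]

/-- **Extension of the spin cylinder identity past the time horizon.** For a continuous-path
process `W` on `(Ω, μ)` whose path map is a.e. measurable, `y > 0`, a time `s` and a bounded
continuous cylinder test function `ψ(W_S)`: if `E_μ[(N^y_t(W) - N^y_s(W)) ψ(W_S)] = 0` for all
`t` with `s < t < T(iy) = y²/9`, then the identity holds for every `t ≥ s` — the time-limited
spin observable `N^y_u` (`spinObservableProcess`) is constant in `u ≥ T(iy)`, continuous in `u`
(`continuous_contSpinObservable_min_cdhksTime`) and bounded by `3`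
(`norm_contSpinObservable_min_le`), so the case `t ≥ T(iy) > s` follows by letting `t ↑ T(iy)`
under the integral (dominated convergence), and the case `s ≥ T(iy)` is trivial. (Spin copy of
`integral_observableProcess_cylinder_eq_zero_of_forall_lt`.) [cite: CDHKSCRAS2014, §3] -/
theorem integral_spinObservableProcess_cylinder_eq_zero_of_forall_lt
    {W : ℝ≥0 → Ω → ℝ} (hWc : ∀ ω, Continuous (W · ω))
    (hWm : AEMeasurable (fun ω ↦ (⟨fun r ↦ W r ω, hWc ω⟩ : C(ℝ≥0, ℝ))) μ)
    {y : ℝ} (hy : 0 < y) {s : ℝ≥0} {n : ℕ} (S : Fin n → ℝ≥0) {ψ : (Fin n → ℝ) → ℝ}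
    (hψc : Continuous ψ) (hψ1 : ∀ v, |ψ v| ≤ 1)
    (h : ∀ t : ℝ≥0, s < t → t < cdhksTime y →
      ∫ ω, (spinObservableProcess W y t ω - spinObservableProcess W y s ω) *
        (ψ (fun i ↦ W (S i) ω) : ℂ) ∂μ = 0)
    {t : ℝ≥0} (hst : s ≤ t) :
    ∫ ω, (spinObservableProcess W y t ω - spinObservableProcess W y s ω) *
      (ψ (fun i ↦ W (S i) ω) : ℂ) ∂μ = 0 := by
  -- the functional `N^y_u(w) = O_{u ∧ T(iy)}^w(iy)` on path space, made opaque
  obtain ⟨N, hN⟩ : ∃ N : ℝ≥0 → C(ℝ≥0, ℝ) → ℂ,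
      N = fun u (w : C(ℝ≥0, ℝ)) ↦ contSpinObservable w (min u (cdhksTime y)) (I * y) := ⟨_, rfl⟩
  have hNc : Continuous (Function.uncurry N) := by
    rw [hN]; exact continuous_contSpinObservable_min_cdhksTime hy
  have hNC : ∀ u w, ‖N u w‖ ≤ 3 := fun u w ↦ by
    rw [hN]; exact norm_contSpinObservable_min_le w.continuous hy u
  have hfreeze : ∀ u : ℝ≥0, cdhksTime y ≤ u → ∀ w, N u w = N (cdhksTime y) w := by
    intro u hu w
    rw [hN]
    simp only [min_eq_right hu, min_self]
  have hobs : ∀ u ω, spinObservableProcess W y u ω = N u ⟨fun r ↦ W r ω, hWc ω⟩ := by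
    intro u ω; rw [hN]; rfl
  simp only [hobs] at h ⊢
  clear hobs
  have hevalc : Continuous fun w : C(ℝ≥0, ℝ) ↦ (fun i ↦ w (S i) : Fin n → ℝ) :=
    continuous_pi fun i ↦ continuous_eval_const (S i)
  have hNt : ∀ u, Continuous fun w : C(ℝ≥0, ℝ) ↦ N u w := fun u ↦
    hNc.comp (continuous_const.prodMk continuous_id)
  have hNu : ∀ w, Continuous fun u : ℝ≥0 ↦ N u w := fun w ↦
    hNc.comp (continuous_id.prodMk continuous_const)
  rcases hst.eq_or_lt with rfl | hst'
  · simp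
  rcases lt_or_ge t (cdhksTime y) with htT | htT
  · exact h t hst' htT
  rcases le_or_gt (cdhksTime y) s with hsT | hsT
  · have h0 : ∀ ω, N t ⟨fun r ↦ W r ω, hWc ω⟩ - N s ⟨fun r ↦ W r ω, hWc ω⟩ = 0 := fun ω ↦ by
      rw [hfreeze t htT, hfreeze s hsT, sub_self]
    simp [h0]
  simp_rw [hfreeze t htT]
  -- approximate `T(iy)` from below by times `tm m ∈ (s, T(iy))`
  obtain ⟨tm, -, htm_mem, htm_lim⟩ := exists_seq_strictMono_tendsto' hsT
  have hm : ∀ m, ∫ ω, (N (tm m) ⟨fun r ↦ W r ω, hWc ω⟩ - N s ⟨fun r ↦ W r ω, hWc ω⟩) *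
      (ψ (fun i ↦ W (S i) ω) : ℂ) ∂μ = 0 :=
    fun m ↦ h (tm m) (htm_mem m).1 (htm_mem m).2
  have hψC : Continuous fun w : C(ℝ≥0, ℝ) ↦ (ψ (fun i ↦ w (S i)) : ℂ) :=
    continuous_ofReal.comp (hψc.comp hevalc)
  have hmeas : ∀ u : ℝ≥0, AEStronglyMeasurable (fun ω ↦ (N u ⟨fun r ↦ W r ω, hWc ω⟩ -
      N s ⟨fun r ↦ W r ω, hWc ω⟩) * (ψ (fun i ↦ W (S i) ω) : ℂ)) μ := fun u ↦ by
    have hc : Continuous fun w : C(ℝ≥0, ℝ) ↦ (N u w - N s w) * (ψ (fun i ↦ w (S i)) : ℂ) :=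
      ((hNt u).sub (hNt s)).mul hψC
    exact (hc.measurable.comp_aemeasurable hWm).aestronglyMeasurable
  have hbd : ∀ (u : ℝ≥0) ω, ‖(N u ⟨fun r ↦ W r ω, hWc ω⟩ - N s ⟨fun r ↦ W r ω, hWc ω⟩) *
      (ψ (fun i ↦ W (S i) ω) : ℂ)‖ ≤ 6 := fun u ω ↦ by
    rw [norm_mul, Complex.norm_real, Real.norm_eq_abs]
    have hu4 := hNC u ⟨fun r ↦ W r ω, hWc ω⟩
    have hs4 := hNC s ⟨fun r ↦ W r ω, hWc ω⟩
    have h1 : ‖N u ⟨fun r ↦ W r ω, hWc ω⟩ - N s ⟨fun r ↦ W r ω, hWc ω⟩‖ ≤ 6 :=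
      (norm_sub_le _ _).trans (by linarith)
    calc ‖N u ⟨fun r ↦ W r ω, hWc ω⟩ - N s ⟨fun r ↦ W r ω, hWc ω⟩‖ * |ψ fun i ↦ W (S i) ω|
        ≤ 6 * 1 := mul_le_mul h1 (hψ1 _) (abs_nonneg _) (by norm_num)
      _ = 6 := by norm_num
  have hlim : Tendsto (fun m ↦ ∫ ω, (N (tm m) ⟨fun r ↦ W r ω, hWc ω⟩ -
      N s ⟨fun r ↦ W r ω, hWc ω⟩) * (ψ (fun i ↦ W (S i) ω) : ℂ) ∂μ) atTop
      (𝓝 (∫ ω, (N (cdhksTime y) ⟨fun r ↦ W r ω, hWc ω⟩ - N s ⟨fun r ↦ W r ω, hWc ω⟩) *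
        (ψ (fun i ↦ W (S i) ω) : ℂ) ∂μ)) := by
    refine tendsto_integral_of_dominated_convergence (fun _ ↦ 6) (fun m ↦ hmeas _)
      (integrable_const _) (fun m ↦ ae_of_all _ fun ω ↦ hbd _ ω) (ae_of_all _ fun ω ↦ ?_)
    exact ((((hNu _).tendsto _).comp htm_lim).sub tendsto_const_nhds).mul tendsto_const_nhds
  have h0 : Tendsto (fun m ↦ ∫ ω, (N (tm m) ⟨fun r ↦ W r ω, hWc ω⟩ -
      N s ⟨fun r ↦ W r ω, hWc ω⟩) * (ψ (fun i ↦ W (S i) ω) : ℂ) ∂μ) atTop (𝓝 0) := by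
    simp_rw [hm]
    exact tendsto_const_nhds
  exact tendsto_nhds_unique hlim h0

/-- **The cylinder identity of the spin observable from discrete observable martingales** (the
analytic clause of the cylinder-identity statement of
`LatticeModels/InterfaceSLECylinder.lean` for a limit `(W, μ)` of driving processes). Let the
continuous-path driving processes `V k` on `(Ω' k, P k)` converge in distribution in
`C([0, ∞), ℝ)` to the continuous-path process `W` on `(Ω, μ)` (for the spin-Ising interfaces
along a subsequence: Kemppainen–Smirnov 2017, Thm. 1.5/Cor. 1.7 with CDHKS Thm. 4 and Rem. 4,
i.e. CDHKS Thm. 3), and let `y > 0`. Suppose that for all `s < t < T(iy) = y²/9` there are a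
constant `C'` and null sequences `ε, Δ, η` such that every scale `k` carries a discrete
filtration `𝒢` (the lattice steps of the exploration), a complex `𝒢`-martingale `F` (the
normalised spin fermionic observable `F^δ_n(z^δ)` of the slit domain `(Ω^δ_n; γ^δ_n, b^δ)` at a
lattice point `z^δ` near `w⁻¹(iy)`, a martingale "with respect to the filtration `(𝓕^δ_n)_{n≥0}`
… generated by the first `n` steps of `γ^δ`", CDHKS §3) and `𝒢`-stopping times `σ ≤ τ ≤ M`
(the first lattice steps of capacity `≥ s`, `≥ t`) such that the driving values `V^k_u`,
`u ≤ s`, are `𝒢_σ`-measurable, `‖F_σ‖, ‖F_τ‖ ≤ C'` a.e., and off an event of probability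
`≤ η_k` the stopped values are within `ε_k` of the time-limited spin observable
`N^y_u(V^k) = spinObservableProcess (V k) y u` at some `u ∈ [s, s + Δ_k]`, resp. `[t, t + Δ_k]`
(Chelkak–Smirnov 2012, Thms 1.2 and 5.6, in CDHKS's form "`|F^δ_n(z) - M^δ_t(z)| → 0` as
`δ → 0` uniformly over all possible domains `Ω^δ_n` and all `z` in the bulk", plus the
capacity overshoot of one lattice step). Then for ALL `s ≤ t`, all finite families of times
`S ≤ s` and all continuous `ψ` with `|ψ| ≤ 1`, `E_μ[(N^y_t(W) - N^y_s(W)) ψ(W_S)] = 0`. PROVED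
(`integral_cylinder_eq_zero_of_discreteMartingales` with the jointly continuous functional
`N^y`, bounded by `3`, for `s < t < T(iy)`; then
`integral_spinObservableProcess_cylinder_eq_zero_of_forall_lt`). This is the step "we conclude
that for any `z ∈ Ω`, the process `M_t(z)`, `t ≤ T(z)`, … is a martingale with respect to the
filtration generated by `W_t`" of CDHKS (2014), §3, given its two lattice inputs.
[cite: CDHKSCRAS2014, Thm. 3 and §3] [cite: ChelkakSmirnov2012, Thms 1.2 and 5.6] -/
theorem integral_spinObservableProcess_cylinder_eq_zero_of_discreteMartingales
    {W : ℝ≥0 → Ω → ℝ} (hWc : ∀ ω, Continuous (W · ω))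
    {V : ∀ k, ℝ≥0 → Ω' k → ℝ} (hVc : ∀ k ω, Continuous (V k · ω))
    (hlaw : TendstoInDistribution (fun k ω ↦ (⟨fun u ↦ V k u ω, hVc k ω⟩ : C(ℝ≥0, ℝ))) atTop
      (fun ω ↦ (⟨fun u ↦ W u ω, hWc ω⟩ : C(ℝ≥0, ℝ))) P μ)
    {y : ℝ} (hy : 0 < y)
    (hD : ∀ s t : ℝ≥0, s < t → t < cdhksTime y →
      ∃ (C' : ℝ) (ε Δ η : ℕ → ℝ≥0), Tendsto ε atTop (𝓝 0) ∧ Tendsto Δ atTop (𝓝 0) ∧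
        Tendsto η atTop (𝓝 0) ∧
        ∀ k, ∃ (𝒢 : Filtration ℕ (mΩ' k)) (F : ℕ → Ω' k → ℂ) (σ τ : Ω' k → WithTop ℕ)
          (hσ : IsStoppingTime 𝒢 σ) (M : ℕ) (bad : Set (Ω' k)),
          IsStoppingTime 𝒢 τ ∧ Martingale F 𝒢 (P k) ∧ σ ≤ τ ∧ (∀ ω, τ ω ≤ M) ∧
          (∀ u, u ≤ s → Measurable[hσ.measurableSpace] (V k u)) ∧
          (∀ᵐ ω ∂P k, ‖stoppedValue F σ ω‖ ≤ C') ∧ (∀ᵐ ω ∂P k, ‖stoppedValue F τ ω‖ ≤ C') ∧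
          MeasurableSet bad ∧ P k bad ≤ η k ∧
          ∀ᵐ ω ∂P k, ω ∉ bad →
            (∃ u ∈ Icc s (s + Δ k), ‖stoppedValue F σ ω - spinObservableProcess (V k) y u ω‖ ≤ ε k) ∧
            (∃ u ∈ Icc t (t + Δ k), ‖stoppedValue F τ ω - spinObservableProcess (V k) y u ω‖ ≤ ε k)) :
    ∀ s t : ℝ≥0, s ≤ t → ∀ (n : ℕ) (S : Fin n → ℝ≥0), (∀ i, S i ≤ s) →
      ∀ ψ : (Fin n → ℝ) → ℝ, Continuous ψ → (∀ v, |ψ v| ≤ 1) →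
        ∫ ω, (spinObservableProcess W y t ω - spinObservableProcess W y s ω) *
          (ψ (fun i ↦ W (S i) ω) : ℂ) ∂μ = 0 := by
  intro s t hst n S hS ψ hψc hψ1
  refine integral_spinObservableProcess_cylinder_eq_zero_of_forall_lt hWc hlaw.aemeasurable_limit hy S
    hψc hψ1 (fun t' hst' ht'T ↦ ?_) hst
  obtain ⟨C', ε, Δ, η, hε, hΔ, hη, hDk⟩ := hD s t' hst' ht'T
  -- the functional `N^y` on path space
  obtain ⟨N, hN⟩ : ∃ N : ℝ≥0 → C(ℝ≥0, ℝ) → ℂ,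
      N = fun u (w : C(ℝ≥0, ℝ)) ↦ contSpinObservable w (min u (cdhksTime y)) (I * y) := ⟨_, rfl⟩
  have hNc : Continuous (Function.uncurry N) := by
    rw [hN]; exact continuous_contSpinObservable_min_cdhksTime hy
  have hNC : ∀ u w, ‖N u w‖ ≤ 3 := fun u w ↦ by
    rw [hN]; exact norm_contSpinObservable_min_le w.continuous hy u
  have hobs : ∀ u ω, spinObservableProcess W y u ω = N u ⟨fun r ↦ W r ω, hWc ω⟩ := by
    intro u ω; rw [hN]; rfl
  have hobsV : ∀ k u ω, spinObservableProcess (V k) y u ω = N u ⟨fun r ↦ V k r ω, hVc k ω⟩ := by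
    intro k u ω; rw [hN]; rfl
  simp only [hobsV] at hDk
  simp only [hobs]
  exact integral_cylinder_eq_zero_of_discreteMartingales hWc hVc hlaw hNc hNC s t' hS hψc hψ1
    hε hΔ hη hDk


end DiscretePassage

end Loewner

end Literature.Probability.RandomPlanarGeometry
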